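import Mathlib
import HarnessLib
import Literature.Analysis.FluidPDE.ClassicalSolution
import Literature.Analysis.FluidPDE.Vorticity
import Summits.NavierStokesRegularity.NavierStokesRegularity.Theorems.QuarterLogPincerBeadCensusDefs
import Summits.NavierStokesRegularity.NavierStokesRegularity.Theorems.QuarterLogPincerBeadCensusKernel
import Summits.NavierStokesRegularity.NavierStokesRegularity.Theorems.QuarterLogPincerCubicRungDefs
import Summits.NavierStokesRegularity.NavierStokesRegularity.Theorems.QuarterLogPincerThinCascadeDefs
import Summits.NavierStokesRegularity.NavierStokesRegularity.Theorems.QuarterLogPincerTypeIQuantSubcubicExpStubUniformScaledEnergy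
import Summits.NavierStokesRegularity.NavierStokesRegularity.Theorems.QuarterLogPincerTypeIQuantSubcubicExpFrameTools
import Summits.NavierStokesRegularity.NavierStokesRegularity.Theorems.QuarterLogPincerTypeIQuantSubcubicExpZoomEnergyA
import Summits.NavierStokesRegularity.NavierStokesRegularity.Theorems.QuarterLogPincerTypeIQuantSubcubicExpRescaleTools
import Summits.NavierStokesRegularity.NavierStokesRegularity.Theorems.QuarterLogPincerTypeIQuantSubcubicExpUnitScaleTools
import Summits.NavierStokesRegularity.NavierStokesRegularity.Theorems.QuarterLogPincerHelmholtzCentreDefs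
import Summits.NavierStokesRegularity.NavierStokesRegularity.Theorems.QuarterLogPincerHelmholtzCentreShellKernel
import Summits.NavierStokesRegularity.NavierStokesRegularity.Theorems.QuarterLogPincerFlatChainDefs
import Summits.NavierStokesRegularity.NavierStokesRegularity.Theorems.QuarterLogPincerFlatChainTypeIEpoch
import Literature.Analysis.FluidPDE.BarkerPrangeLocalizedSmoothingBounds
import Literature.Analysis.FluidPDE.BarkerPrangeConcentrationProofs
import Literature.Analysis.FluidPDE.BackwardHeatPointwise
import Literature.Analysis.FluidPDE.AncientWeakL3BackwardLiouvilleAssembly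
import Literature.Analysis.FluidPDE.LocalEnergySolutionsOn
import Literature.Analysis.FluidPDE.LocalLerayExistence
import Literature.Analysis.FluidPDE.BoundedMildWeakL3LocalEnergySolution
import Literature.Analysis.FluidPDE.BoundedMildWeakL3RieszPressure
import Literature.Analysis.FluidPDE.KatoLocalLerayPressureProofs
import Literature.Analysis.FluidPDE.VeryWeakToDistributional
import Literature.Analysis.FluidPDE.VeryWeakToDistributionalFour
import Literature.Analysis.FluidPDE.ClassicalBoundedWeak
import Literature.Analysis.FluidPDE.MildSolution
import Literature.Analysis.SingularIntegrals.HardyLittlewoodSobolev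
import Literature.Analysis.FluidPDE.VorticityCalculus
import Literature.Analysis.FluidPDE.BiotSavartWeakLp
import Summits.NavierStokesRegularity.NavierStokesRegularity.Theorems.QuarterLogPincerFlatChainSliceDefs
import Literature.Analysis.FluidPDE.CKNDecayScheme
import Literature.Analysis.FluidPDE.LeiZhang2011Proofs

/-!
# Route `QuarterLogPincer`, crux `TypeIQuantSubcubicExp` (stmt-NavierStokesRegularity-24077), line `flat_chain` —
# §11 tools for S1 (`q4_*` lemmas: I1 at an interior time, Cauchy–Schwarz on balls, endpoint by continuity, the arithmetic of the
# quiet slice), the author's proofs VERBATIM (three helpers that restated tree lemmas are replaced by the tree names: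
# `volume_real_ball_eq`, `CKN1982.rpow_three_halves_le_self`, and — inlined at its use — `eLpNorm_three_le_of_lintegral_cube_le`)

HONEST FRAME: ports of the author's kernel-checked in-file proofs about HYPOTHETICAL Type-I classical solutions; no census node,
⟨24077⟩, W7 or Navier–Stokes regularity is proved (OPEN).  pub-ns-dss typer (g39), `--supports stmt-NavierStokesRegularity-24077`;
texts by ns-idea-7 (g14), workfile `Cruxes/TypeIQuantSubcubicExp/Lines/flat_chain.lean` v1.12 (sha f4adcfe506ba), VERBATIM.
-/

set_option linter.dupNamespace false

namespace Summit.NavierStokesRegularity.NavierStokesRegularity.Cruxes.TypeIQuantSubcubicExp.FlatChain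

noncomputable section

open MeasureTheory Set Metric
open scoped ENNReal NNReal Classical
open Literature.Analysis Literature.Analysis.FluidPDE
open Summit.NavierStokesRegularity.NavierStokesRegularity.Cruxes.TypeIQuantSubcubicExp.BeadCensus
open Summit.NavierStokesRegularity.NavierStokesRegularity.Cruxes.TypeIQuantSubcubicExp.CubicRung

/-! ### §11 (v1.12) **Q4|P PROVED**: `levelConcentration_of_slice_holds : LocalEnergySlice → QuietSliceSmallCube → LevelConcentration`

S1 `LevelConcentration` from P (`LocalEnergySlice`, PROVED v1.11) and Q3 (`QuietSliceSmallCube`, PROVED v1.3) by the PROVED tree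
theorems `BarkerPrange2020_thm1_slab_bounds` (i) (small-`L³` short-time sup bound for local energy solutions, Barker–Prange 2020
Thm 1) and I1 `ThinCascade.stub_uniformScaledEnergy` (scale-uniform `r⁻¹∫_{B_r}|u|² ≤ C(M)`), in the sup-rate gauge and by
contraposition: a quiet slice `∫_{B(x₀,ρ√σ)}|ω(t*)|² < ησ^{-1/2}` at some `t* ∈ [t₁−4σ, t₁−σ]` (`σ = s_{k+1}/D`) makes
`‖u(t*)‖_{L³(B(x₀,2r))} ≤ γ` with `r² = (t₁−t*)/S_BP` (Q3 + Cauchy–Schwarz + I1, `ρ` large then `η` small, both depending on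
`M` only), whence BP (i) on the rescaled slice `v = sliceField u x₀ t* r` bounds `‖v‖ ≤ C` on `(S/2,S) × B(0,1/3)`, hence at the
endpoint `(S,0)` by joint continuity, i.e. `‖u(t₁,x₀)‖ ≤ C/r ≤ C√(SD)·e^{a(k+1)}/√t₁ < e^{a(n+1)}/√t₁` once `e^{a} > C√(SD)` —
contradicting the violator.  Everything used is a kernel-checked theorem; no new obligation. -/

section Q4Proof

open Summit.NavierStokesRegularity.NavierStokesRegularity.Cruxes.TypeIQuantSubcubicExp.ThinCascade
  (TaoFrame UniformScaledEnergy stub_uniformScaledEnergy)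
open Summit.NavierStokesRegularity.NavierStokesRegularity.Theorems.ThinCascade
  (frame_restrict typeI_restrict)
open Filter Topology

/-- I1 at an interior time `t* ∈ [0,T]` and any radius `R'` with `R'² ≤ T` (auxiliary vertex `min (t* + R'²) T`). -/
theorem q4_I1_lintegral_at {M C T τ : ℝ}
    (hC : ∀ (T τ : ℝ) (u : ℝ → EuclideanSpace ℝ (Fin 3) → EuclideanSpace ℝ (Fin 3))
      (p : ℝ → EuclideanSpace ℝ (Fin 3) → ℝ), TaoFrame T u p → 0 < τ →
      (∀ t ∈ Icc 0 T, ∀ x : EuclideanSpace ℝ (Fin 3), ‖u t x‖ ≤ M * (T + τ - t) ^ (-(1 / 2 : ℝ))) →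
      ∀ (x : EuclideanSpace ℝ (Fin 3)) (r : ℝ), 0 < r → r ^ 2 ≤ T →
        (∀ t ∈ Icc (T - r ^ 2) T,
          ∫⁻ y in ball x r, ENNReal.ofReal (‖u t y‖ ^ 2) ≤ ENNReal.ofReal (C * r)) ∧
        (∫⁻ t in Icc (T - r ^ 2) T, ∫⁻ y in ball x r,
          ENNReal.ofReal (‖fderiv ℝ (u t) y‖ ^ 2) ≤ ENNReal.ofReal (C * r)) ∧
        (∫⁻ t in Icc (T - r ^ 2) T, ∫⁻ y in ball x r,
          ENNReal.ofReal (|p t y - ⨍ z in ball x r, p t z| ^ (3 / 2 : ℝ)) ≤ ENNReal.ofReal (C * r ^ 2)))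
    {u : ℝ → EuclideanSpace ℝ (Fin 3) → EuclideanSpace ℝ (Fin 3)} {p : ℝ → EuclideanSpace ℝ (Fin 3) → ℝ}
    (hfr : TaoFrame T u p) (hτ : 0 < τ)
    (hrate : ∀ t ∈ Icc 0 T, ∀ x : EuclideanSpace ℝ (Fin 3), ‖u t x‖ ≤ M * (T + τ - t) ^ (-(1 / 2 : ℝ)))
    (x : EuclideanSpace ℝ (Fin 3)) {tstar R' : ℝ} (hR' : 0 < R') (ht0 : 0 ≤ tstar) (htT : tstar ≤ T)
    (hRT : R' ^ 2 ≤ T) :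
    ∫⁻ y in ball x R', ENNReal.ofReal (‖u tstar y‖ ^ 2) ≤ ENNReal.ofReal (max C 0 * R') := by
  have hR2 : 0 < R' ^ 2 := by positivity
  set T' : ℝ := min (tstar + R' ^ 2) T with hT'
  have hT'T : T' ≤ T := min_le_right _ _
  have htT' : tstar ≤ T' := le_min (by linarith) htT
  have hrT' : R' ^ 2 ≤ T' := le_min (by linarith) hRT
  have hT'0 : 0 < T' := lt_of_lt_of_le hR2 hrT'
  have hwin : tstar ∈ Icc (T' - R' ^ 2) T' :=
    ⟨by rw [hT']; have := min_le_left (tstar + R' ^ 2) T; linarith, htT'⟩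
  have hfr' : TaoFrame T' u p := frame_restrict hfr hT'0 hT'T
  have hrate' := typeI_restrict hrate hT'T
  have hτ' : 0 < T - T' + τ := by linarith
  have hA := (hC T' (T - T' + τ) u p hfr' hτ' hrate' x R' hR' hrT').1 tstar hwin
  exact hA.trans (ENNReal.ofReal_le_ofReal (mul_le_mul_of_nonneg_right (le_max_left _ _) hR'.le))

/-- I1 at an interior time, Bochner form: `∫_{B(x,R')} ‖u(t*)‖² ≤ C₊ R'`. -/
theorem q4_I1_integral_at {M C T τ : ℝ}
    (hC : ∀ (T τ : ℝ) (u : ℝ → EuclideanSpace ℝ (Fin 3) → EuclideanSpace ℝ (Fin 3))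
      (p : ℝ → EuclideanSpace ℝ (Fin 3) → ℝ), TaoFrame T u p → 0 < τ →
      (∀ t ∈ Icc 0 T, ∀ x : EuclideanSpace ℝ (Fin 3), ‖u t x‖ ≤ M * (T + τ - t) ^ (-(1 / 2 : ℝ))) →
      ∀ (x : EuclideanSpace ℝ (Fin 3)) (r : ℝ), 0 < r → r ^ 2 ≤ T →
        (∀ t ∈ Icc (T - r ^ 2) T,
          ∫⁻ y in ball x r, ENNReal.ofReal (‖u t y‖ ^ 2) ≤ ENNReal.ofReal (C * r)) ∧
        (∫⁻ t in Icc (T - r ^ 2) T, ∫⁻ y in ball x r,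
          ENNReal.ofReal (‖fderiv ℝ (u t) y‖ ^ 2) ≤ ENNReal.ofReal (C * r)) ∧
        (∫⁻ t in Icc (T - r ^ 2) T, ∫⁻ y in ball x r,
          ENNReal.ofReal (|p t y - ⨍ z in ball x r, p t z| ^ (3 / 2 : ℝ)) ≤ ENNReal.ofReal (C * r ^ 2)))
    {u : ℝ → EuclideanSpace ℝ (Fin 3) → EuclideanSpace ℝ (Fin 3)} {p : ℝ → EuclideanSpace ℝ (Fin 3) → ℝ}
    (hfr : TaoFrame T u p) (hτ : 0 < τ)
    (hrate : ∀ t ∈ Icc 0 T, ∀ x : EuclideanSpace ℝ (Fin 3), ‖u t x‖ ≤ M * (T + τ - t) ^ (-(1 / 2 : ℝ)))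
    (x : EuclideanSpace ℝ (Fin 3)) {tstar R' : ℝ} (hR' : 0 < R') (ht0 : 0 ≤ tstar) (htT : tstar ≤ T)
    (hRT : R' ^ 2 ≤ T) :
    ∫ y in ball x R', ‖u tstar y‖ ^ 2 ≤ max C 0 * R' := by
  have hcont : Continuous (u tstar) := (hfr.1.contDiff_velocity ⟨ht0, htT⟩).continuous
  have hint : IntegrableOn (fun y => ‖u tstar y‖ ^ 2) (ball x R') volume :=
    ((hcont.norm.pow 2).continuousOn.integrableOn_compact (isCompact_closedBall x R')).mono_set
      ball_subset_closedBall
  have h := q4_I1_lintegral_at hC hfr hτ hrate x hR' ht0 htT hRT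
  rw [← ofReal_integral_eq_lintegral_ofReal hint (ae_of_all _ fun y => sq_nonneg _)] at h
  exact (ENNReal.ofReal_le_ofReal_iff (by positivity)).1 h

/-- Cauchy–Schwarz on a ball for a continuous field: `∫_B ‖w‖ ≤ √(|B| ∫_B ‖w‖²)`. [folklore] -/
theorem q4_integral_norm_le_sqrt {F : Type*} [NormedAddCommGroup F]
    {w : EuclideanSpace ℝ (Fin 3) → F} (hw : Continuous w) (x : EuclideanSpace ℝ (Fin 3)) (R' : ℝ) :
    ∫ y in ball x R', ‖w y‖ ≤ Real.sqrt (volume.real (ball x R') * ∫ y in ball x R', ‖w y‖ ^ 2) :=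
  Carleman.setIntegral_le_sqrt_measure_mul_setIntegral_sq measure_ball_lt_top.ne measurableSet_ball
    (fun _ _ => norm_nonneg _) hw.norm.aestronglyMeasurable
    (((hw.norm.pow 2).continuousOn.integrableOn_compact (isCompact_closedBall x R')).mono_set
      ball_subset_closedBall)

/-- **Endpoint bound by joint continuity**: a bound on the open box `(S/2,S) × B(0,1/3)` of a field continuous on
`[0,S] × ℝ³` holds at the corner point `(S, 0)`. [folklore] -/
theorem q4_norm_endpoint_le {v : ℝ → EuclideanSpace ℝ (Fin 3) → EuclideanSpace ℝ (Fin 3)} {S C : ℝ} (hS : 0 < S)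
    (hcont : ContinuousOn (Function.uncurry v) (Icc 0 S ×ˢ (univ : Set (EuclideanSpace ℝ (Fin 3)))))
    (hall : ∀ w ∈ Ioo (S / 2) S ×ˢ ball (0 : EuclideanSpace ℝ (Fin 3)) (1 / 3), ‖Function.uncurry v w‖ ≤ C) :
    ‖v S 0‖ ≤ C := by
  set Bx : Set (ℝ × EuclideanSpace ℝ (Fin 3)) := Ioo (S / 2) S ×ˢ ball (0 : EuclideanSpace ℝ (Fin 3)) (1 / 3) with hBx
  have hsub : Bx ⊆ Icc 0 S ×ˢ (univ : Set (EuclideanSpace ℝ (Fin 3))) :=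
    prod_mono (fun t ht => ⟨by linarith [ht.1], ht.2.le⟩) (subset_univ _)
  have hmemA : ((S, (0 : EuclideanSpace ℝ (Fin 3))) : ℝ × EuclideanSpace ℝ (Fin 3)) ∈
      Icc 0 S ×ˢ (univ : Set (EuclideanSpace ℝ (Fin 3))) := ⟨⟨hS.le, le_rfl⟩, mem_univ _⟩
  have hcw : ContinuousWithinAt (Function.uncurry v) Bx (S, 0) := (hcont (S, 0) hmemA).mono hsub
  have hcl : ((S, (0 : EuclideanSpace ℝ (Fin 3))) : ℝ × EuclideanSpace ℝ (Fin 3)) ∈ closure Bx := by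
    rw [hBx, closure_prod_eq, closure_Ioo (by linarith : S / 2 ≠ S),
      closure_ball (0 : EuclideanSpace ℝ (Fin 3)) (by norm_num : (1 / 3 : ℝ) ≠ 0)]
    exact ⟨⟨by linarith, le_rfl⟩, mem_closedBall_self (by norm_num)⟩
  haveI : (𝓝[Bx] ((S, (0 : EuclideanSpace ℝ (Fin 3))) : ℝ × EuclideanSpace ℝ (Fin 3))).NeBot :=
    mem_closure_iff_nhdsWithin_neBot.1 hcl
  have ht : Tendsto (fun w => ‖Function.uncurry v w‖) (𝓝[Bx] (S, 0)) (𝓝 ‖v S 0‖) := hcw.tendsto.norm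
  exact le_of_tendsto ht (eventually_nhdsWithin_of_forall hall)

/-- **The arithmetic of Q4**: with `R = ρq/2`, `r² ≤ 4q²/S`, `W ≤ η/q`, the Cauchy–Schwarz bounds `I_u² ≤ |B_{2R}|·C₊(2R)`,
`I_ω² ≤ |B_{2R}|·W` and the parameter choices `ρ ≥ max(1, K₂/g)`, `η ≤ min(√S/2·m, Sρm²/(64B))` (`m = min 1 g`), the three
Q3 terms are each `≤ g`. -/
theorem q4_arith {B CI S ρ η q r R W Iu Iω g : ℝ}
    (hB : 0 < B) (hCI : 0 ≤ CI) (hS : 0 < S) (hq : 0 < q) (hr : 0 < r) (hW0 : 0 ≤ W) (hIu0 : 0 ≤ Iu)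
    (hIω0 : 0 ≤ Iω) (hg0 : 0 < g) (hρ1 : 1 ≤ ρ)
    (hρK : (16 * Real.sqrt (B * CI) / Real.sqrt S) ^ 3 / g ≤ ρ)
    (hη1 : η ≤ Real.sqrt S / 2 * min 1 g) (hη2 : η ≤ S * ρ * (min 1 g) ^ 2 / (64 * B))
    (hR : R = ρ * q / 2) (hr2 : r ^ 2 ≤ 4 * q ^ 2 / S) (hW : W ≤ η / q)
    (hIu : Iu ^ 2 ≤ B * (2 * R) ^ 3 * (CI * (2 * R))) (hIω : Iω ^ 2 ≤ B * (2 * R) ^ 3 * W) :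
    r ^ (3 / 2 : ℝ) * W ^ (3 / 2 : ℝ) + r ^ 3 * ((R ^ 3)⁻¹ * Iu) ^ 3 + r ^ 3 * ((R ^ 2)⁻¹ * Iω) ^ 3 ≤ 3 * g := by
  have hmin0 : 0 < min 1 g := lt_min one_pos hg0
  have hmin1 : min 1 g ≤ 1 := min_le_left _ _
  have hming : min 1 g ≤ g := min_le_right _ _
  have hsqS : 0 < Real.sqrt S := Real.sqrt_pos.2 hS
  have hsqS2 : Real.sqrt S ^ 2 = S := Real.sq_sqrt hS.le
  have hρ0 : 0 < ρ := by linarith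
  have hR0 : 0 < R := by rw [hR]; positivity
  -- `r ≤ 2q/√S`
  have hr_le : r ≤ 2 * q / Real.sqrt S := by
    have h : r ^ 2 ≤ (2 * q / Real.sqrt S) ^ 2 := by
      rw [div_pow, mul_pow, hsqS2]; linarith [hr2]
    exact (pow_le_pow_iff_left₀ hr.le (by positivity) two_ne_zero).1 h
  -- term 1
  have hrW : r * W ≤ 2 * η / Real.sqrt S :=
    calc r * W ≤ (2 * q / Real.sqrt S) * (η / q) := mul_le_mul hr_le hW hW0 (by positivity)
      _ = 2 * η / Real.sqrt S := by field_simp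
  have hrW1 : r * W ≤ min 1 g := by
    refine hrW.trans ?_
    rw [div_le_iff₀ hsqS]
    calc 2 * η ≤ 2 * (Real.sqrt S / 2 * min 1 g) := by linarith
      _ = min 1 g * Real.sqrt S := by ring
  have hT1 : r ^ (3 / 2 : ℝ) * W ^ (3 / 2 : ℝ) ≤ g := by
    rw [← Real.mul_rpow hr.le hW0]
    calc (r * W) ^ (3 / 2 : ℝ) ≤ r * W := CKN1982.rpow_three_halves_le_self (by positivity) (hrW1.trans hmin1)
      _ ≤ g := hrW1.trans hming
  -- term 2
  have hIu_le : Iu ≤ 4 * R ^ 2 * Real.sqrt (B * CI) := by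
    have h2 : Iu ^ 2 ≤ (4 * R ^ 2 * Real.sqrt (B * CI)) ^ 2 := by
      calc Iu ^ 2 ≤ B * (2 * R) ^ 3 * (CI * (2 * R)) := hIu
        _ = (4 * R ^ 2) ^ 2 * (B * CI) := by ring
        _ = (4 * R ^ 2 * Real.sqrt (B * CI)) ^ 2 := by
            rw [mul_pow (4 * R ^ 2), Real.sq_sqrt (by positivity)]
    exact (pow_le_pow_iff_left₀ hIu0 (by positivity) two_ne_zero).1 h2
  have hb2 : (R ^ 3)⁻¹ * Iu * r ≤ 16 * Real.sqrt (B * CI) / Real.sqrt S / ρ := by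
    calc (R ^ 3)⁻¹ * Iu * r ≤ (R ^ 3)⁻¹ * (4 * R ^ 2 * Real.sqrt (B * CI)) * (2 * q / Real.sqrt S) := by
          gcongr
      _ = 16 * Real.sqrt (B * CI) / Real.sqrt S / ρ := by
          rw [hR]; field_simp; ring
  have hT2 : r ^ 3 * ((R ^ 3)⁻¹ * Iu) ^ 3 ≤ g := by
    have hb0 : 0 ≤ (R ^ 3)⁻¹ * Iu * r := by positivity
    set K : ℝ := (16 * Real.sqrt (B * CI) / Real.sqrt S) ^ 3 with hK
    have hK0 : 0 ≤ K := by positivity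
    have hKρ : K ≤ ρ * g := (div_le_iff₀ hg0).1 hρK
    calc r ^ 3 * ((R ^ 3)⁻¹ * Iu) ^ 3 = ((R ^ 3)⁻¹ * Iu * r) ^ 3 := by ring
      _ ≤ (16 * Real.sqrt (B * CI) / Real.sqrt S / ρ) ^ 3 := pow_le_pow_left₀ hb0 hb2 3
      _ = K / ρ ^ 3 := by rw [hK, div_pow]
      _ ≤ K / ρ := div_le_div_of_nonneg_left hK0 hρ0 (le_self_pow₀ hρ1 three_ne_zero)
      _ ≤ g := by
          rw [div_le_iff₀ hρ0]
          calc K ≤ ρ * g := hKρ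
            _ = g * ρ := mul_comm _ _
  -- term 3
  have hb3sq : ((R ^ 2)⁻¹ * Iω * r) ^ 2 ≤ 64 * B * η / (S * ρ) := by
    calc ((R ^ 2)⁻¹ * Iω * r) ^ 2 = (R ^ 2)⁻¹ ^ 2 * Iω ^ 2 * r ^ 2 := by ring
      _ ≤ (R ^ 2)⁻¹ ^ 2 * (B * (2 * R) ^ 3 * W) * (4 * q ^ 2 / S) := by gcongr
      _ = 32 * B * q ^ 2 * W / (R * S) := by field_simp; ring
      _ ≤ 32 * B * q ^ 2 * (η / q) / (R * S) := by gcongr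
      _ = 64 * B * η / (S * ρ) := by rw [hR]; field_simp; ring
  have h64 : 64 * B * η ≤ S * ρ * (min 1 g) ^ 2 := by
    have := (le_div_iff₀ (by positivity : (0 : ℝ) < 64 * B)).1 hη2
    calc 64 * B * η = η * (64 * B) := by ring
      _ ≤ S * ρ * (min 1 g) ^ 2 := this
  have hb3sq' : ((R ^ 2)⁻¹ * Iω * r) ^ 2 ≤ (min 1 g) ^ 2 := by
    refine hb3sq.trans ?_
    rw [div_le_iff₀ (by positivity)]
    calc 64 * B * η ≤ S * ρ * (min 1 g) ^ 2 := h64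
      _ = (min 1 g) ^ 2 * (S * ρ) := by ring
  have hb30 : 0 ≤ (R ^ 2)⁻¹ * Iω * r := by positivity
  have hb3 : (R ^ 2)⁻¹ * Iω * r ≤ min 1 g := (pow_le_pow_iff_left₀ hb30 hmin0.le two_ne_zero).1 hb3sq'
  have hT3 : r ^ 3 * ((R ^ 2)⁻¹ * Iω) ^ 3 ≤ g := by
    calc r ^ 3 * ((R ^ 2)⁻¹ * Iω) ^ 3 = ((R ^ 2)⁻¹ * Iω * r) ^ 3 := by ring
      _ ≤ (min 1 g) ^ 3 := pow_le_pow_left₀ hb30 hb3 3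
      _ ≤ min 1 g := pow_le_of_le_one hmin0.le hmin1 three_ne_zero
      _ ≤ g := hming
  linarith [hT1, hT2, hT3]

/-- `e^{-a} ≤ c` once `1 ≤ c·e^{a}`. -/
theorem q4_exp_neg_le {a c : ℝ} (h : 1 ≤ c * Real.exp a) : Real.exp (-a) ≤ c :=
  calc Real.exp (-a) = Real.exp (-a) * 1 := (mul_one _).symm
    _ ≤ Real.exp (-a) * (c * Real.exp a) := mul_le_mul_of_nonneg_left h (Real.exp_pos _).le
    _ = c := by rw [mul_left_comm, ← Real.exp_add, neg_add_cancel, Real.exp_zero, mul_one]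

end Q4Proof


end

end Summit.NavierStokesRegularity.NavierStokesRegularity.Cruxes.TypeIQuantSubcubicExp.FlatChain
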